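import Summits.QuantumFields.BalabanUV.T4Continuum.Support.NE9LinSizeEnd
import Summits.QuantumFields.BalabanUV.T4Continuum.Support.NE9MarginalProjection
import Summits.QuantumFields.BalabanUV.T4Continuum.Support.NE9LinSizeCurrencyBudgetKP
import Summits.QuantumFields.BalabanUV.T4Continuum.Support.NE9FadingArithmeticRider

/-!
# NE9LinSizeEndProj — E5′-P: the d-currency torus END face of row NE9 IN THE CORRECTED DICTIONARY `T := 𝒯 ∘ P` (the history
channel fed the PROJECTED old terms), and leaf N2's rider `(1 + cr·a)` ON THIS FACE'S OWN binder shapes (cell `pub-balaban`, T4-DAG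
§2 node U3 / §6 NE9; rung (B)+1 on a FIXED finite T⁴; NE9 formalisation crew, unit `b2b-balaban-t4-ne9-formalise-leaf-07` gen 3;
companion of (w10) `NE9FadingArithmeticRider` (gen 2) and of `NE9LinSizeEnd` (E5′, crew row (w13) part 2))

HONEST FRAMING (T4-DAG PAGE 1).  Rung (B)+1 = existence and uniqueness of the ε → 0 limit of gauge-invariant observables on a
FIXED finite torus T⁴ — NOT infinite volume, NOT a mass gap, NOT the Clay problem.  NE9 is a cell NEW ESTIMATE, NOT PRINTED and
NOT discharged here: §1–§2 are COMPOSITIONS BY NAME of landed END faces (every analytic input stays a DISPLAYED binder — (A″) the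
(2.38)-TYPE decay of the box majorant in `d`, (L‴) the (2.20)-summand decay of the coefficient tables, the recursion side, the
read-out/projection binders), §3 is OUR OWN real arithmetic on the letters of §1's rate.  0 `def`, 0 `sorry`, no END face re-wired;
[I]/[II] locators are TYPE locators only (ABSOLUTE RULE); `FlowStep.BetaPertH`, (B), (B^μ) do not occur.  HONEST DEPENDENCY
(verbatim): continuum YM on T⁴ ⇐ BetaPertH ∧ nine spine estimates (0/9 proved); BetaPertH ⇐ (D1) ∧ (D4) ∧ CAP+tail; G-an2-4 gates
asym, D1 and NE2/3/4.

WHY.  The owner's located correction O-ne9p1g22-1 (skeleton SKELETON-NE9-P1 v1.3 §7, `NE9MarginalProjection`): leaf S5's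
per-creation-step fading is a property of the MARGINAL-FREE packages (0.28) p. 258 of [I] only, so the frame's channel is
`T := 𝒯 ∘ P` with `P` the re-attachment of the counterterm of (1.3) p. 260 through the read-out (1.20)–(1.22) p. 264; the channel
binders are then those of `𝒯` ON THE MARGINAL-FREE CLASS plus four projection binders, at the price `τ ↦ (1 + c)·τ` on the
channel weight (`channelSizeAtStepNN_compProj`).  The owner landed this at END-V·S (`NE9MarginalProjectionEnd`), crew row (w12)
rider (b) at the carriers of record in cube currency (`Spine/NE9/CarriersOfRecordFacesProj`).  THIS FILE does it for the face in
PRINT'S currency — E5′ (`NE9LinSizeEnd.torus_termSize_ne9_and_fadingMemory_of_linSizeDischargers`: KP clause, extracted decay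
(2.27), pin budget and pinned sums (1.26) all in Bałaban's linear size `d`, ADDITIVE rate) — and records what the (w10) factor does
to the N2 readings of that face (N2-ter §B `NE9LinSizeCurrencyBudgetKP`; census `NE9FadingCensus.md` §8).

WHAT IS PROVED (kernel).
§1 **E5′-P `torus_termSize_ne9_and_fadingMemory_of_linSizeDischargers_compProj`**: E5′ at `T := compProj 𝒯 P`; its `hadd` /
   `hsum` / `hstep` are DISCHARGED from the same three binders for `𝒯` on `MF` and `ProjAdditive` / `ProjScaleComm` / `ProjInto` /
   `ProjSize … c`; every other E5′ binder is passed UNCHANGED except `T ↦ 𝒯 ∘ P` and `τ ↦ (1 + c)·τ` (the `hbox` radius);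
   conclusion LITERALLY `TermSize E W κ Nsz ∧ NE9 E W κ (prodModuli ℓ fun _ => μ_P) ∧ FadingMemory (ℓ/μ_P) μ_P (…)` with
   **`μ_P = ω + 4·lipbar·(a₁·e^{−a″(ν+1)})·((1 + c)·τ̄)`**.
§2 `…_margProj` — `P := margProj r A`, `c = cr·aA`: three projection binders DERIVED from `ReadAdditive` / `ReadZero` /
   `ReadSize … cr` (node U2's (R) via `readSize_of_readBoundedOn`) and `DirSize A κ aA`, `ProjInto` displayed; `…_margProj_of_dLe` —
   the same with E5′'s comparability split as `C.d X ≤ d(cubes X)` ([dict]) and the ADDITIVE rate `κ ≤ a″`.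
§3 N2 ON THIS FACE (letters of §1; pure real arithmetic, displayed-binder SHAPES copied token for token):
   `linSmall_iff` — E5′'s KP smallness `(D+1)(2ε′)e^{a″(ν+1)+2^ν(a₁+log 2)}2^(ν+1+2^ν) ≤ a₁` IS N2-ter §B's shape at
   `ε := ε′·2^{2^ν}`; `fade_necessary_linProj` — fading of `μ_P` REQUIRES the polynomial smallness
   `8(D+1)(2^(ν+1+2^ν))²·α4·(ε′2^{2^ν})·((1+c)τ̄) < 1 − ω` (N2-ter §B `fade_necessary_lin` BY NAME at `τ̄ := (1+c)τ̄`);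
   `fade_necessary_linProj_floor` — with the kernel FLOOR `1 ≤ c` of (w10) (`one_le_readConst_mul_dirSize`: `cr·a ≥ 1` whenever the
   read-out is normalised on the marginal direction) the necessary smallness DOUBLES: `16(D+1)(2^(ν+1+2^ν))²·2^{2^ν}·α4·ε′·τ̄ <
   1 − ω` (T⁴: `144·2^58·α4·ε′·τ̄ < 1 − ω`, `fade_necessary_linProj_floor_T4`); `fade_sufficient_linProj` — N2-ter §B's
   sufficiency at `(1+c)τ̄`: fading on E5′-P is still NOT an extra exponential smallness; `fade_linProj_iff_lt_exp` /
   `fade_linProj_iff_log_lt` / `fade_linProj_mono` — the census §8 reading in kernel: for `ω < 1` and a positive product,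
   `μ_P < 1 ↔ log(4·lipbar·a₁·(1+c)·τ̄/(1 − ω)) < a″·(ν+1)` — a LOWER bound on the decay-weight rate `a″ ≥ κ` (TYPE «κ sufficiently
   large», [I] Thm 3 p. 264, [II] p. 18), monotone in `a″`, in which `(1 + c)` enters under the logarithm.
DISGUISE TEST.  §1–§2: every discharged binder is a one-history statement (structure of a linear projection, sizes); no second
history, no coupling difference — not NE9 in disguise; the conclusion is the root BY NAME.  §3: arithmetic on displayed letters.
NOT DONE HERE: the same on `NE9MultiScaleChart.msChart` (leaf-10-g2's named residual); nothing about Bałaban's activities,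
channel or tables (O-NE9-1).

References (TYPE locators only; nothing printed is a hypothesis): T. Bałaban, CMP **109** (1987) 249–301 [Balaban1987RG1] (0.23)
p. 256, p. 257, (0.28)–(0.29) p. 258, (1.3) p. 260, (1.18) p. 263, Thm 3 p. 264, (1.20)–(1.22) p. 264; CMP **116** (1988) 1–22
[Balaban1988RG2Cluster] p. 8 l. 9–10, (1.26) p. 8, (1.36) p. 9, p. 18 text, (2.27) p. 18, (2.38) p. 20, (2.41) p. 21;
R. Kotecký, D. Preiss, CMP **103** (1986) [KoteckyPreiss1986].
-/

noncomputable section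

namespace Summit.QuantumFields.BalabanUV.T4Continuum.NE9LinSizeEndProj

open scoped BigOperators
open Metric Set MeasureTheory BoundedContinuousFunction
open Literature.Probability.LatticeModels
open Literature.MathematicalPhysics.QuantumFieldTheory
open Literature.MathematicalPhysics.QuantumFieldTheory.Balaban1983to89
open Literature.MathematicalPhysics.QuantumFieldTheory.Balaban1983to89.T4OutputRate
open Literature.MathematicalPhysics.QuantumFieldTheory.Balaban1983to89.T4ActivityLipschitz
open Literature.MathematicalPhysics.QuantumFieldTheory.Balaban1983to89.T4HistoryLipschitzRecursion
open Literature.MathematicalPhysics.QuantumFieldTheory.Balaban1983to89.T4HistoryLipschitzOuter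
open Literature.MathematicalPhysics.QuantumFieldTheory.Balaban1983to89.T4HistoryLipschitzActivity
open Literature.MathematicalPhysics.QuantumFieldTheory.Balaban1983to89.T4HistoryLipschitzEntropy
open Literature.MathematicalPhysics.QuantumFieldTheory.Balaban1983to89.T4HistoryLipschitzCubeGeometry
open Literature.MathematicalPhysics.QuantumFieldTheory.Balaban1983to89.T4HistoryLipschitzActivity (ClusterGeom)
open Literature.MathematicalPhysics.QuantumFieldTheory.Balaban1983to89.T4HistoryLipschitzSegment
open Literature.MathematicalPhysics.QuantumFieldTheory.Balaban1983to89.T4HistoryLipschitzLinearSize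
open Summit.QuantumFields.BalabanUV.T4Continuum.NE9MarginalProjection
open Summit.QuantumFields.BalabanUV.T4Continuum.NE9LinSizeEnd

/-! ## §1 E5′-P: the d-currency torus face at `T := 𝒯 ∘ P` -/

section Torus

variable {ν N : ℕ} {C : Carriers} {D : ℕ}
variable {Bg : Type} {Sp : Type*} [TopologicalSpace Sp] [MeasurableSpace Sp] [OpensMeasurableSpace Sp] {F : Type*}
  [Fintype F] {Ω : Type*} [MeasurableSpace Ω]

/-- **E5′-P — E5′ WITH THE HISTORY CHANNEL FED THE PROJECTED OLD TERMS (kernel composition BY NAME).**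
`NE9LinSizeEnd.torus_termSize_ne9_and_fadingMemory_of_linSizeDischargers` applied at `T := compProj 𝒯 P`: the channel binders
`hadd` / `hsum` / `hstep` now concern `𝒯` ON THE MARGINAL-FREE CLASS `MF` (leaf S5 in its corrected reading: the printed gain `L^jη`
per creation step, [II] p. 8 l. 9–10, is claimed for the marginal-free packages (0.28) p. 258 of [I] only) together with
`ProjAdditive` / `ProjScaleComm` / `ProjInto` / `ProjSize … cP` (the re-attachment of the counterterm of (1.3) p. 260 through the
linear read-out (1.20)–(1.22) p. 264 costs the factor `1 + cP` in the (1.18) currency); `Factorises`, `LastCouplingLipschitz` and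
the occupation radius of `hbox` are read at `𝒯 ∘ P` and at the weights `(1 + cP)·τ`; every other binder of E5′ VERBATIM (KP
clause, (2.27) decay extraction, pin budget, pinned sums (1.26), all in Bałaban's linear size; ADDITIVE rate condition).
Conclusion: `TermSize` and the root with rate letter **`μ_P = ω + 4·lipbar·(a₁·e^{−a″(ν+1)})·((1 + cP)·τ̄)`**.
[cite: Balaban1987RG1, (0.28)-(0.29) p.258, (1.3) p.260, (1.18) p.263, (1.20)-(1.22) p.264; Balaban1988RG2Cluster, p.8 l.9-10, (1.26) p.8, (1.36) p.9, (2.27) p.18, Lemma 3 (2.38) p.20, (2.40)-(2.41) p.21; KoteckyPreiss1986, (1)-(3)] -/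
theorem torus_termSize_ne9_and_fadingMemory_of_linSizeDischargers_compProj
    (Γ : CubeChart C (Fin ν → ZMod N) (torusAdj ν N) D) {ι : Type} {E : Functional C Bg}
    {W : Set (ℕ → ℝ)} {Adm MF : Set (Bg → C.Dom → ℝ)} {P : (Bg → C.Dom → ℝ) → (Bg → C.Dom → ℝ)}
    {𝒯 : ℕ → (ℕ → ℝ) → (Bg → C.Dom → ℝ) → ι → ℝ} {Ψ : ℕ → ℝ → (ι → ℝ) → Bg → C.Dom → ℝ}
    {μ : ℕ → ℝ → Bg → Finset (Fin ν → ZMod N) → Measure Ω} {pre : ℕ → ℝ → Bg → Finset (Fin ν → ZMod N) → Ω → ℂ}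
    {c : ℕ → ℝ → Bg → Finset (Fin ν → ZMod N) → Ω → F → ℂ}
    {pt : ℕ → ℝ → Bg → Finset (Fin ν → ZMod N) → Ω → F → Sp} {β : ℕ → Sp → ℝ}
    {dom : ℕ → Finset (Fin ν → ZMod N) → F → Finset (Fin ν → ZMod N)}
    {lip ε' α4 : ℕ → ℝ} {a₁ a'' κ lipbar ℓ τbar ω a a' cP : ℝ} {wt : ℕ → ι → ℝ} {τ : ℕ → ℕ → ℝ} {lam p₀ Nsz : ℕ → ℝ}
    (ρ : ℕ → (ι → ℝ) → (Sp →ᵇ ℂ))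
    (h0 : ScaleZeroFree E W) (hAdm : AdmissibleTerms E W Adm) (hres : AdmRestrict Adm)
    -- the projection binders and the channel binders ON THE MARGINAL-FREE CLASS
    (hPadd : ProjAdditive Adm P) (hPcomm : ProjScaleComm Adm P) (hPinto : ProjInto Adm MF P) (hPsize : ProjSize Adm P κ cP)
    (hcP : 0 ≤ cP) (hadd : ChannelAdditive MF 𝒯) (hsum : ChannelStepSum MF 𝒯) (hstep : ChannelSizeAtStepNN MF 𝒯 κ wt τ)
    -- E5′'s remaining recursion-side binders at `T := 𝒯 ∘ P`
    (hfac : Factorises E W (compProj 𝒯 P) Ψ) (hlast : LastCouplingLipschitz E W (compProj 𝒯 P) Ψ κ lam)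
    (hρ : ∀ (k : ℕ) (Q Q' : ι → ℝ) (M : ℝ), (∀ y, |Q y - Q' y| ≤ wt k y * M) → ‖ρ k Q - ρ k Q'‖ ≤ M)
    (hΨ : ∀ (k : ℕ) (s : ℝ) (Q Q' : ι → ℝ) (U : Bg) (X : C.Dom),
      Ψ k s Q U X - Ψ k s Q' U X =
        (Γ.geom.newTerm (Γ.geom.avgExpLinearAct μ pre fun k s U γ ω => evalFunctional (c k s U γ ω) (pt k s U γ ω))
            k s U X (ρ k Q) -
          Γ.geom.newTerm (Γ.geom.avgExpLinearAct μ pre fun k s U γ ω => evalFunctional (c k s U γ ω) (pt k s U γ ω))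
            k s U X (ρ k Q')).re)
    (hexpl : ∀ g ∈ W, ∀ (k : ℕ) (Q : ι → ℝ) (U : Bg) (X : C.Dom), C.scale X = k + 1 →
      |Ψ k (g k) Q U X -
          (Γ.geom.newTerm (Γ.geom.avgExpLinearAct μ pre fun k s U γ ω => evalFunctional (c k s U γ ω) (pt k s U γ ω))
            k (g k) U X (ρ k Q)).re| ≤ Real.exp (-(κ * C.d X)) * p₀ k)
    (hbase : ∀ g ∈ W, ∀ (U : Bg) (X : C.Dom), C.scale X = 0 → |E g U X| ≤ Real.exp (-(κ * C.d X)) * Nsz 0)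
    (hNsucc : ∀ j, p₀ j + a₁ * Real.exp (-(a'' * (ν + 1))) ≤ Nsz (j + 1)) (hNnn : ∀ j, 0 ≤ Nsz j)
    (hbox : ∀ (k : ℕ) (Q : ι → ℝ), (∀ y, |Q y| ≤ wt k y * sizeRadius (fun k j => (1 + cP) * τ k j) Nsz k) →
      ∀ x, ‖ρ k Q x‖ ≤ β k x)
    (hpre : ∀ k s U γ, AEStronglyMeasurable (pre k s U γ) (μ k s U γ))
    (hc : ∀ k s U γ Y, AEStronglyMeasurable (fun ω => c k s U γ ω Y) (μ k s U γ))
    (hpt : ∀ k s U γ Y, Measurable fun ω => pt k s U γ ω Y) (hlip : ∀ k, 0 < lip k) (hlipb : ∀ k, lip k ≤ lipbar)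
    (hint₀ : ∀ k s U γ, Integrable (fun ω => ‖pre k s U γ ω‖ * Real.exp (boxExponent c pt β k s U γ ω)) (μ k s U γ))
    (hmeet : ∀ k s U (γ : Finset (Fin ν → ZMod N)) ω Y, c k s U γ ω Y ≠ 0 → ∃ x ∈ γ, x ∈ dom k γ Y)
    (hα4 : ∀ k, 0 ≤ α4 k) (ha : (2:ℝ) ^ ν * Real.log 2 + Real.log (8 * ν) ≤ a)
    (hliplb : ∀ k, α4 k * 2 ^ (ν + 1 + 2 ^ ν) ≤ lip k)
    (hlin : ∀ k s U (γ : Finset (Fin ν → ZMod N)) ω Y,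
      ‖c k s U γ ω Y‖ ≤ α4 k * Real.exp (-(a * (linSize (dom k γ Y) : ℝ))))
    (hdomconn : ∀ k (γ : Finset (Fin ν → ZMod N)) Y, (dom k γ Y).Nonempty →
      ∃ b ∈ dom k γ Y, Polymer.IsConn (torusAdj ν N) (dom k γ Y) b)
    (hdominj : ∀ k (γ : Finset (Fin ν → ZMod N)), Set.InjOn (dom k γ) {Y | (dom k γ Y).Nonempty})
    (hXconn : ∀ X, ∃ b, Polymer.IsConn (torusAdj ν N) (Γ.cubes X) b)
    (hcmp : ∀ X, κ * C.d X ≤ a'' * (linSize (Γ.cubes X) : ℝ))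
    (hε' : ∀ k, 0 ≤ ε' k)
    (hdecayLin : ∀ g ∈ W, ∀ (k : ℕ) (U : Bg) (X : C.Dom), C.scale X = k + 1 → ∀ γ' ∈ Γ.vol X,
      ∫ ω, ‖pre k (g k) U γ' ω‖ * Real.exp (boxExponent c pt β k (g k) U γ' ω) ∂(μ k (g k) U γ') ≤
        ε' k * Real.exp (-(a' * (linSize γ' : ℝ))))
    (ha₁ : 0 ≤ a₁) (ha'' : 0 ≤ a'')
    (hrate : (2:ℝ) ^ ν * Real.log 2 + Real.log (8 * ν) ≤ a' - a'' - 2 ^ ν * (a₁ + Real.log 2))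
    (hsmall : ∀ k, ((D : ℝ) + 1) * (2 * ε' k) * Real.exp (a'' * (ν + 1) + 2 ^ ν * (a₁ + Real.log 2)) *
      2 ^ (ν + 1 + 2 ^ ν) ≤ a₁)
    (hℓ : 0 ≤ ℓ) (hτbar : 0 ≤ τbar) (hω : 0 ≤ ω)
    (hpos : 0 < ω + 4 * lipbar * (a₁ * Real.exp (-(a'' * (ν + 1)))) * ((1 + cP) * τbar))
    (hlam : ∀ k, lam k ≤ ℓ) (hτ : ∀ k j, j ≤ k → 0 ≤ τ k j ∧ τ k j ≤ τbar * ω ^ (k - j)) :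
    TermSize E W κ Nsz ∧
      NE9 E W κ (prodModuli ℓ fun _ => ω + 4 * lipbar * (a₁ * Real.exp (-(a'' * (ν + 1)))) * ((1 + cP) * τbar)) ∧
        FadingMemory (ℓ / (ω + 4 * lipbar * (a₁ * Real.exp (-(a'' * (ν + 1)))) * ((1 + cP) * τbar)))
          (ω + 4 * lipbar * (a₁ * Real.exp (-(a'' * (ν + 1)))) * ((1 + cP) * τbar))
          (prodModuli ℓ fun _ => ω + 4 * lipbar * (a₁ * Real.exp (-(a'' * (ν + 1)))) * ((1 + cP) * τbar)) := by
  have hτ' : ∀ k j, j ≤ k → 0 ≤ (1 + cP) * τ k j ∧ (1 + cP) * τ k j ≤ (1 + cP) * τbar * ω ^ (k - j) :=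
    compWeights_profile hcP hτ
  have hτbar' : 0 ≤ (1 + cP) * τbar := mul_nonneg (by linarith) hτbar
  exact torus_termSize_ne9_and_fadingMemory_of_linSizeDischargers Γ ρ h0 hAdm hres
    (channelAdditive_compProj hPadd hPinto hadd) (channelStepSum_compProj hPcomm hPinto hsum)
    (channelSizeAtStepNN_compProj hPcomm hPinto hPsize hcP hstep) hfac hlast hρ hΨ hexpl hbase hNsucc hNnn hbox hpre hc hpt
    hlip hlipb hint₀ hmeet hα4 ha hliplb hlin hdomconn hdominj hXconn hcmp hε' hdecayLin ha₁ ha'' hrate hsmall hℓ hτbar' hω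
    hpos hlam hτ'

/-! ## §2 The same with the READ-OUT projection `P := margProj r A` (`c = cr·aA`) -/

/-- **E5′-P WITH THE READ-OUT PROJECTION** `P := margProj r A` (`c = cr·aA`): three of the four projection binders are DERIVED
from the read-out's additivity / zero / size (`ReadSize … cr` = node U2's (R) in the per-step currency, junction
`readSize_of_readBoundedOn`; `cr` NOT PRINTED, cell GAPS C-ne4p1-7) and the marginal direction's size `DirSize A κ aA` (one-cube
Wilson action, elementary with O1); `ProjInto` (the projected families are marginal-free) stays displayed.  Rate letter
**`ω + 4·lipbar·(a₁·e^{−a″(ν+1)})·((1 + cr·aA)·τ̄)`**.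
[cite: Balaban1987RG1, (0.28)-(0.29) p.258, (1.3) p.260, (1.11)-(1.14) p.262, (1.18) p.263, (1.20)-(1.22) p.264; Balaban1988RG2Cluster, (1.26) p.8, (1.36) p.9, (2.27) p.18, (2.38) p.20, (2.41) p.21] -/
theorem torus_termSize_ne9_and_fadingMemory_of_linSizeDischargers_margProj
    (Γ : CubeChart C (Fin ν → ZMod N) (torusAdj ν N) D) {ι : Type} {E : Functional C Bg}
    {W : Set (ℕ → ℝ)} {Adm MF : Set (Bg → C.Dom → ℝ)} {r : ℕ → (Bg → C.Dom → ℝ) → ℝ} {A : Bg → C.Dom → ℝ}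
    {𝒯 : ℕ → (ℕ → ℝ) → (Bg → C.Dom → ℝ) → ι → ℝ} {Ψ : ℕ → ℝ → (ι → ℝ) → Bg → C.Dom → ℝ}
    {μ : ℕ → ℝ → Bg → Finset (Fin ν → ZMod N) → Measure Ω} {pre : ℕ → ℝ → Bg → Finset (Fin ν → ZMod N) → Ω → ℂ}
    {c : ℕ → ℝ → Bg → Finset (Fin ν → ZMod N) → Ω → F → ℂ}
    {pt : ℕ → ℝ → Bg → Finset (Fin ν → ZMod N) → Ω → F → Sp} {β : ℕ → Sp → ℝ}
    {dom : ℕ → Finset (Fin ν → ZMod N) → F → Finset (Fin ν → ZMod N)}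
    {lip ε' α4 : ℕ → ℝ} {a₁ a'' κ lipbar ℓ τbar ω a a' cr aA : ℝ} {wt : ℕ → ι → ℝ} {τ : ℕ → ℕ → ℝ}
    {lam p₀ Nsz : ℕ → ℝ} (ρ : ℕ → (ι → ℝ) → (Sp →ᵇ ℂ))
    (h0 : ScaleZeroFree E W) (hAdm : AdmissibleTerms E W Adm) (hres : AdmRestrict Adm)
    -- the read-out, the marginal direction, the marginal-free class
    (hrA : ReadAdditive Adm r) (hr0 : ReadZero r) (hrs : ReadSize Adm r κ cr) (hA : DirSize A κ aA) (hcr : 0 ≤ cr)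
    (haA : 0 ≤ aA) (hPinto : ProjInto Adm MF (margProj r A))
    (hadd : ChannelAdditive MF 𝒯) (hsum : ChannelStepSum MF 𝒯) (hstep : ChannelSizeAtStepNN MF 𝒯 κ wt τ)
    -- E5′'s remaining recursion-side binders at `T := 𝒯 ∘ margProj r A`
    (hfac : Factorises E W (compProj 𝒯 (margProj r A)) Ψ)
    (hlast : LastCouplingLipschitz E W (compProj 𝒯 (margProj r A)) Ψ κ lam)
    (hρ : ∀ (k : ℕ) (Q Q' : ι → ℝ) (M : ℝ), (∀ y, |Q y - Q' y| ≤ wt k y * M) → ‖ρ k Q - ρ k Q'‖ ≤ M)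
    (hΨ : ∀ (k : ℕ) (s : ℝ) (Q Q' : ι → ℝ) (U : Bg) (X : C.Dom),
      Ψ k s Q U X - Ψ k s Q' U X =
        (Γ.geom.newTerm (Γ.geom.avgExpLinearAct μ pre fun k s U γ ω => evalFunctional (c k s U γ ω) (pt k s U γ ω))
            k s U X (ρ k Q) -
          Γ.geom.newTerm (Γ.geom.avgExpLinearAct μ pre fun k s U γ ω => evalFunctional (c k s U γ ω) (pt k s U γ ω))
            k s U X (ρ k Q')).re)
    (hexpl : ∀ g ∈ W, ∀ (k : ℕ) (Q : ι → ℝ) (U : Bg) (X : C.Dom), C.scale X = k + 1 →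
      |Ψ k (g k) Q U X -
          (Γ.geom.newTerm (Γ.geom.avgExpLinearAct μ pre fun k s U γ ω => evalFunctional (c k s U γ ω) (pt k s U γ ω))
            k (g k) U X (ρ k Q)).re| ≤ Real.exp (-(κ * C.d X)) * p₀ k)
    (hbase : ∀ g ∈ W, ∀ (U : Bg) (X : C.Dom), C.scale X = 0 → |E g U X| ≤ Real.exp (-(κ * C.d X)) * Nsz 0)
    (hNsucc : ∀ j, p₀ j + a₁ * Real.exp (-(a'' * (ν + 1))) ≤ Nsz (j + 1)) (hNnn : ∀ j, 0 ≤ Nsz j)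
    (hbox : ∀ (k : ℕ) (Q : ι → ℝ), (∀ y, |Q y| ≤ wt k y * sizeRadius (fun k j => (1 + cr * aA) * τ k j) Nsz k) →
      ∀ x, ‖ρ k Q x‖ ≤ β k x)
    (hpre : ∀ k s U γ, AEStronglyMeasurable (pre k s U γ) (μ k s U γ))
    (hc : ∀ k s U γ Y, AEStronglyMeasurable (fun ω => c k s U γ ω Y) (μ k s U γ))
    (hpt : ∀ k s U γ Y, Measurable fun ω => pt k s U γ ω Y) (hlip : ∀ k, 0 < lip k) (hlipb : ∀ k, lip k ≤ lipbar)
    (hint₀ : ∀ k s U γ, Integrable (fun ω => ‖pre k s U γ ω‖ * Real.exp (boxExponent c pt β k s U γ ω)) (μ k s U γ))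
    (hmeet : ∀ k s U (γ : Finset (Fin ν → ZMod N)) ω Y, c k s U γ ω Y ≠ 0 → ∃ x ∈ γ, x ∈ dom k γ Y)
    (hα4 : ∀ k, 0 ≤ α4 k) (ha : (2:ℝ) ^ ν * Real.log 2 + Real.log (8 * ν) ≤ a)
    (hliplb : ∀ k, α4 k * 2 ^ (ν + 1 + 2 ^ ν) ≤ lip k)
    (hlin : ∀ k s U (γ : Finset (Fin ν → ZMod N)) ω Y,
      ‖c k s U γ ω Y‖ ≤ α4 k * Real.exp (-(a * (linSize (dom k γ Y) : ℝ))))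
    (hdomconn : ∀ k (γ : Finset (Fin ν → ZMod N)) Y, (dom k γ Y).Nonempty →
      ∃ b ∈ dom k γ Y, Polymer.IsConn (torusAdj ν N) (dom k γ Y) b)
    (hdominj : ∀ k (γ : Finset (Fin ν → ZMod N)), Set.InjOn (dom k γ) {Y | (dom k γ Y).Nonempty})
    (hXconn : ∀ X, ∃ b, Polymer.IsConn (torusAdj ν N) (Γ.cubes X) b)
    (hcmp : ∀ X, κ * C.d X ≤ a'' * (linSize (Γ.cubes X) : ℝ))
    (hε' : ∀ k, 0 ≤ ε' k)
    (hdecayLin : ∀ g ∈ W, ∀ (k : ℕ) (U : Bg) (X : C.Dom), C.scale X = k + 1 → ∀ γ' ∈ Γ.vol X,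
      ∫ ω, ‖pre k (g k) U γ' ω‖ * Real.exp (boxExponent c pt β k (g k) U γ' ω) ∂(μ k (g k) U γ') ≤
        ε' k * Real.exp (-(a' * (linSize γ' : ℝ))))
    (ha₁ : 0 ≤ a₁) (ha'' : 0 ≤ a'')
    (hrate : (2:ℝ) ^ ν * Real.log 2 + Real.log (8 * ν) ≤ a' - a'' - 2 ^ ν * (a₁ + Real.log 2))
    (hsmall : ∀ k, ((D : ℝ) + 1) * (2 * ε' k) * Real.exp (a'' * (ν + 1) + 2 ^ ν * (a₁ + Real.log 2)) *
      2 ^ (ν + 1 + 2 ^ ν) ≤ a₁)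
    (hℓ : 0 ≤ ℓ) (hτbar : 0 ≤ τbar) (hω : 0 ≤ ω)
    (hpos : 0 < ω + 4 * lipbar * (a₁ * Real.exp (-(a'' * (ν + 1)))) * ((1 + cr * aA) * τbar))
    (hlam : ∀ k, lam k ≤ ℓ) (hτ : ∀ k j, j ≤ k → 0 ≤ τ k j ∧ τ k j ≤ τbar * ω ^ (k - j)) :
    TermSize E W κ Nsz ∧
      NE9 E W κ (prodModuli ℓ fun _ => ω + 4 * lipbar * (a₁ * Real.exp (-(a'' * (ν + 1)))) * ((1 + cr * aA) * τbar)) ∧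
        FadingMemory (ℓ / (ω + 4 * lipbar * (a₁ * Real.exp (-(a'' * (ν + 1)))) * ((1 + cr * aA) * τbar)))
          (ω + 4 * lipbar * (a₁ * Real.exp (-(a'' * (ν + 1)))) * ((1 + cr * aA) * τbar))
          (prodModuli ℓ fun _ => ω + 4 * lipbar * (a₁ * Real.exp (-(a'' * (ν + 1)))) * ((1 + cr * aA) * τbar)) :=
  torus_termSize_ne9_and_fadingMemory_of_linSizeDischargers_compProj Γ ρ h0 hAdm hres (projAdditive_margProj A hrA)
    (projScaleComm_margProj Adm A hr0) hPinto (projSize_margProj hrs hA hcr) (mul_nonneg hcr haA) hadd hsum hstep hfac hlast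
    hρ hΨ hexpl hbase hNsucc hNnn hbox hpre hc hpt hlip hlipb hint₀ hmeet hα4 ha hliplb hlin hdomconn hdominj hXconn hcmp hε'
    hdecayLin ha₁ ha'' hrate hsmall hℓ hτbar hω hpos hlam hτ

/-- **E5′-P, READ-OUT PROJECTION, RATE DISPLAYED AS `κ ≤ a″`** (the face of record for O-NE9-1's dictionary
`T := 𝒯 ∘ margProj r A`): §2 with E5′'s comparability split into the [dict] clause `C.d X ≤ d(cubes X)` (the carriers' decay
length IS Bałaban's `d_k`, [I] p. 257) and the ADDITIVE rate `κ ≤ a″` ((2.29)–(2.30) p. 18 / (2.41) p. 21-type loss).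
[cite: Balaban1987RG1, p.257, (1.3) p.260, (1.20)-(1.22) p.264; Balaban1988RG2Cluster, (2.29)-(2.30) p.18, (2.41) p.21] -/
theorem torus_termSize_ne9_and_fadingMemory_of_linSizeDischargers_margProj_of_dLe
    (Γ : CubeChart C (Fin ν → ZMod N) (torusAdj ν N) D) {ι : Type} {E : Functional C Bg}
    {W : Set (ℕ → ℝ)} {Adm MF : Set (Bg → C.Dom → ℝ)} {r : ℕ → (Bg → C.Dom → ℝ) → ℝ} {A : Bg → C.Dom → ℝ}
    {𝒯 : ℕ → (ℕ → ℝ) → (Bg → C.Dom → ℝ) → ι → ℝ} {Ψ : ℕ → ℝ → (ι → ℝ) → Bg → C.Dom → ℝ}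
    {μ : ℕ → ℝ → Bg → Finset (Fin ν → ZMod N) → Measure Ω} {pre : ℕ → ℝ → Bg → Finset (Fin ν → ZMod N) → Ω → ℂ}
    {c : ℕ → ℝ → Bg → Finset (Fin ν → ZMod N) → Ω → F → ℂ}
    {pt : ℕ → ℝ → Bg → Finset (Fin ν → ZMod N) → Ω → F → Sp} {β : ℕ → Sp → ℝ}
    {dom : ℕ → Finset (Fin ν → ZMod N) → F → Finset (Fin ν → ZMod N)}
    {lip ε' α4 : ℕ → ℝ} {a₁ a'' κ lipbar ℓ τbar ω a a' cr aA : ℝ} {wt : ℕ → ι → ℝ} {τ : ℕ → ℕ → ℝ}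
    {lam p₀ Nsz : ℕ → ℝ} (ρ : ℕ → (ι → ℝ) → (Sp →ᵇ ℂ))
    (h0 : ScaleZeroFree E W) (hAdm : AdmissibleTerms E W Adm) (hres : AdmRestrict Adm)
    (hrA : ReadAdditive Adm r) (hr0 : ReadZero r) (hrs : ReadSize Adm r κ cr) (hA : DirSize A κ aA) (hcr : 0 ≤ cr)
    (haA : 0 ≤ aA) (hPinto : ProjInto Adm MF (margProj r A))
    (hadd : ChannelAdditive MF 𝒯) (hsum : ChannelStepSum MF 𝒯) (hstep : ChannelSizeAtStepNN MF 𝒯 κ wt τ)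
    (hfac : Factorises E W (compProj 𝒯 (margProj r A)) Ψ)
    (hlast : LastCouplingLipschitz E W (compProj 𝒯 (margProj r A)) Ψ κ lam)
    (hρ : ∀ (k : ℕ) (Q Q' : ι → ℝ) (M : ℝ), (∀ y, |Q y - Q' y| ≤ wt k y * M) → ‖ρ k Q - ρ k Q'‖ ≤ M)
    (hΨ : ∀ (k : ℕ) (s : ℝ) (Q Q' : ι → ℝ) (U : Bg) (X : C.Dom),
      Ψ k s Q U X - Ψ k s Q' U X =
        (Γ.geom.newTerm (Γ.geom.avgExpLinearAct μ pre fun k s U γ ω => evalFunctional (c k s U γ ω) (pt k s U γ ω))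
            k s U X (ρ k Q) -
          Γ.geom.newTerm (Γ.geom.avgExpLinearAct μ pre fun k s U γ ω => evalFunctional (c k s U γ ω) (pt k s U γ ω))
            k s U X (ρ k Q')).re)
    (hexpl : ∀ g ∈ W, ∀ (k : ℕ) (Q : ι → ℝ) (U : Bg) (X : C.Dom), C.scale X = k + 1 →
      |Ψ k (g k) Q U X -
          (Γ.geom.newTerm (Γ.geom.avgExpLinearAct μ pre fun k s U γ ω => evalFunctional (c k s U γ ω) (pt k s U γ ω))
            k (g k) U X (ρ k Q)).re| ≤ Real.exp (-(κ * C.d X)) * p₀ k)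
    (hbase : ∀ g ∈ W, ∀ (U : Bg) (X : C.Dom), C.scale X = 0 → |E g U X| ≤ Real.exp (-(κ * C.d X)) * Nsz 0)
    (hNsucc : ∀ j, p₀ j + a₁ * Real.exp (-(a'' * (ν + 1))) ≤ Nsz (j + 1)) (hNnn : ∀ j, 0 ≤ Nsz j)
    (hbox : ∀ (k : ℕ) (Q : ι → ℝ), (∀ y, |Q y| ≤ wt k y * sizeRadius (fun k j => (1 + cr * aA) * τ k j) Nsz k) →
      ∀ x, ‖ρ k Q x‖ ≤ β k x)
    (hpre : ∀ k s U γ, AEStronglyMeasurable (pre k s U γ) (μ k s U γ))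
    (hc : ∀ k s U γ Y, AEStronglyMeasurable (fun ω => c k s U γ ω Y) (μ k s U γ))
    (hpt : ∀ k s U γ Y, Measurable fun ω => pt k s U γ ω Y) (hlip : ∀ k, 0 < lip k) (hlipb : ∀ k, lip k ≤ lipbar)
    (hint₀ : ∀ k s U γ, Integrable (fun ω => ‖pre k s U γ ω‖ * Real.exp (boxExponent c pt β k s U γ ω)) (μ k s U γ))
    (hmeet : ∀ k s U (γ : Finset (Fin ν → ZMod N)) ω Y, c k s U γ ω Y ≠ 0 → ∃ x ∈ γ, x ∈ dom k γ Y)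
    (hα4 : ∀ k, 0 ≤ α4 k) (ha : (2:ℝ) ^ ν * Real.log 2 + Real.log (8 * ν) ≤ a)
    (hliplb : ∀ k, α4 k * 2 ^ (ν + 1 + 2 ^ ν) ≤ lip k)
    (hlin : ∀ k s U (γ : Finset (Fin ν → ZMod N)) ω Y,
      ‖c k s U γ ω Y‖ ≤ α4 k * Real.exp (-(a * (linSize (dom k γ Y) : ℝ))))
    (hdomconn : ∀ k (γ : Finset (Fin ν → ZMod N)) Y, (dom k γ Y).Nonempty →
      ∃ b ∈ dom k γ Y, Polymer.IsConn (torusAdj ν N) (dom k γ Y) b)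
    (hdominj : ∀ k (γ : Finset (Fin ν → ZMod N)), Set.InjOn (dom k γ) {Y | (dom k γ Y).Nonempty})
    (hXconn : ∀ X, ∃ b, Polymer.IsConn (torusAdj ν N) (Γ.cubes X) b)
    -- the [dict] clause and the ADDITIVE rate
    (hdle : ∀ X, C.d X ≤ (linSize (Γ.cubes X) : ℝ)) (hκ : 0 ≤ κ) (hκa : κ ≤ a'')
    (hε' : ∀ k, 0 ≤ ε' k)
    (hdecayLin : ∀ g ∈ W, ∀ (k : ℕ) (U : Bg) (X : C.Dom), C.scale X = k + 1 → ∀ γ' ∈ Γ.vol X,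
      ∫ ω, ‖pre k (g k) U γ' ω‖ * Real.exp (boxExponent c pt β k (g k) U γ' ω) ∂(μ k (g k) U γ') ≤
        ε' k * Real.exp (-(a' * (linSize γ' : ℝ))))
    (ha₁ : 0 ≤ a₁)
    (hrate : (2:ℝ) ^ ν * Real.log 2 + Real.log (8 * ν) ≤ a' - a'' - 2 ^ ν * (a₁ + Real.log 2))
    (hsmall : ∀ k, ((D : ℝ) + 1) * (2 * ε' k) * Real.exp (a'' * (ν + 1) + 2 ^ ν * (a₁ + Real.log 2)) *
      2 ^ (ν + 1 + 2 ^ ν) ≤ a₁)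
    (hℓ : 0 ≤ ℓ) (hτbar : 0 ≤ τbar) (hω : 0 ≤ ω)
    (hpos : 0 < ω + 4 * lipbar * (a₁ * Real.exp (-(a'' * (ν + 1)))) * ((1 + cr * aA) * τbar))
    (hlam : ∀ k, lam k ≤ ℓ) (hτ : ∀ k j, j ≤ k → 0 ≤ τ k j ∧ τ k j ≤ τbar * ω ^ (k - j)) :
    TermSize E W κ Nsz ∧
      NE9 E W κ (prodModuli ℓ fun _ => ω + 4 * lipbar * (a₁ * Real.exp (-(a'' * (ν + 1)))) * ((1 + cr * aA) * τbar)) ∧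
        FadingMemory (ℓ / (ω + 4 * lipbar * (a₁ * Real.exp (-(a'' * (ν + 1)))) * ((1 + cr * aA) * τbar)))
          (ω + 4 * lipbar * (a₁ * Real.exp (-(a'' * (ν + 1)))) * ((1 + cr * aA) * τbar))
          (prodModuli ℓ fun _ => ω + 4 * lipbar * (a₁ * Real.exp (-(a'' * (ν + 1)))) * ((1 + cr * aA) * τbar)) :=
  torus_termSize_ne9_and_fadingMemory_of_linSizeDischargers_margProj Γ ρ h0 hAdm hres hrA hr0 hrs hA hcr haA hPinto hadd hsum
    hstep hfac hlast hρ hΨ hexpl hbase hNsucc hNnn hbox hpre hc hpt hlip hlipb hint₀ hmeet hα4 ha hliplb hlin hdomconn hdominj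
    hXconn (fun X => (mul_le_mul_of_nonneg_left (hdle X) hκ).trans (mul_le_mul_of_nonneg_right hκa (Nat.cast_nonneg _)))
    hε' hdecayLin ha₁ (hκ.trans hκa) hrate hsmall hℓ hτbar hω hpos hlam hτ

end Torus

end Summit.QuantumFields.BalabanUV.T4Continuum.NE9LinSizeEndProj

end
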